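import Summits.ValiantsHypothesis.ValiantsHypothesis.Theorems.DivisionGapZeroOneTransferSignedSpan

/-!
# Route DivisionGap, crux `ZeroOneTransfer` (stmt-ValiantsHypothesis-5066), line `arborescence-span` —
# the CONVERSE NORMAL FORM: a division certificate of small degree is one Kirchhoff quotient

`stub_spanOfCertificate` (registered support stub of the lead's skeleton): over the semifield
`ℝ≥0`, a division certificate `f · h = g` (`h ≠ 0`) whose two monotone polynomials `g`, `h` have
complexity `≤ 2^E`, total degree `< 2^E` and live on `≤ 2^E` variables is ONE Kirchhoff quotient
of quasi-polynomial size: `f · A = B` with `A ≠ 0` and `A, B` positive Valiant projections of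
Jerrum–Snir's `stPoly ℝ≥0 N`, `N ≤ 2^(700 E²)`.

Together with the reduction file (`DivisionGapZeroOneTransferSpanReduction.lean`: a two-sided span
of size `N` gives a division certificate of size `poly(N)`) this makes precise the planner's finding
recorded on the line card: the bet `stub_signElimination` (Kirchhoff sign elimination) is
`ZeroOneTransfer` WITH A QUASI-POLYNOMIAL BOUND ON THE COFACTOR DEGREE, written in Kirchhoff normal
form — "quasi-polynomial `{+, ×, ÷}`-complexity with a quasi-polynomial-degree certificate = one
Kirchhoff quotient of quasi-polynomial size".

## Proof

Monotone balancing is the tree's `formulaComplexity_le_two_pow` over the commutative SEMIRING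
`ℝ≥0` (VSBR + Brent need no subtraction): `g`, `h` have monotone formulas of size `≤ 2^{18E²}`;
`stub_formulaToIMM` at `k = ℝ≥0` makes them entries of products of labelled matrices; the two
programs are run side by side as ONE block-diagonal labelled program on `Fin w_h ⊕ Fin w_g`
(layers `diag(M_h, 1)` then `diag(1, M_g)`, `FormulaToIMM.prod_map_inl/inr`), so that the padding
lemma `stub_immToSpan` serves both with the SAME nonzero `A`: `h · A = B₁`, `g · A = B₂`; hence
`f · B₁ = f h A = g A = B₂` with `B₁ = h A ≠ 0`.  Sizes: `SignedSpan.span_size_le`.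
-/

noncomputable section

-- Sub = Summit single-conjunct layout: the duplicated namespace component is mandated by the tree.
set_option linter.dupNamespace false

namespace Summit.ValiantsHypothesis.ValiantsHypothesis.Theorems.DivisionGapZeroOneTransfer

open Literature.Computability.AlgebraicComplexity Literature.Barriers.ValiantsHypothesis
open MvPolynomial Finset
open scoped NNReal

namespace SpanOfCertificate

variable {τ : Type} {a b : ℕ}

/-- Entries of a left-embedded labelled layer `diag(M, 1)` are labels. [folklore] -/
theorem isLab_inl {M : Matrix (Fin a) (Fin a) (MvPolynomial τ ℝ≥0)}
    (hM : ∀ i j, (∃ x, M i j = X x) ∨ ∃ c, M i j = C c) (i j : Fin a ⊕ Fin b) :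
    (∃ x, Matrix.fromBlocks M 0 0 (1 : Matrix (Fin b) (Fin b) (MvPolynomial τ ℝ≥0)) i j = X x) ∨
      ∃ c, Matrix.fromBlocks M 0 0 (1 : Matrix (Fin b) (Fin b) (MvPolynomial τ ℝ≥0)) i j = C c := by
  rcases i with i | i <;> rcases j with j | j
  · simpa using hM i j
  · exact Or.inr ⟨0, by simp⟩
  · exact Or.inr ⟨0, by simp⟩
  · rcases eq_or_ne i j with h | h
    · exact Or.inr ⟨1, by simp [h]⟩
    · exact Or.inr ⟨0, by simp [h]⟩

/-- Entries of a right-embedded labelled layer `diag(1, M)` are labels. [folklore] -/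
theorem isLab_inr {M : Matrix (Fin b) (Fin b) (MvPolynomial τ ℝ≥0)}
    (hM : ∀ i j, (∃ x, M i j = X x) ∨ ∃ c, M i j = C c) (i j : Fin a ⊕ Fin b) :
    (∃ x, Matrix.fromBlocks (1 : Matrix (Fin a) (Fin a) (MvPolynomial τ ℝ≥0)) 0 0 M i j = X x) ∨
      ∃ c, Matrix.fromBlocks (1 : Matrix (Fin a) (Fin a) (MvPolynomial τ ℝ≥0)) 0 0 M i j = C c := by
  rcases i with i | i <;> rcases j with j | j
  · rcases eq_or_ne i j with h | h
    · exact Or.inr ⟨1, by simp [h]⟩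
    · exact Or.inr ⟨0, by simp [h]⟩
  · exact Or.inr ⟨0, by simp⟩
  · exact Or.inr ⟨0, by simp⟩
  · simpa using hM i j

/-- **Two labelled programs side by side.**  The block-diagonal program with layers
`diag(M_h l, 1)` (`l < d_h`) followed by `diag(1, M_g l)` (`l < d_g`) is labelled and computes
`diag(ΠM_h, ΠM_g)`. [folklore] -/
theorem prod_append_blocks {dh dg : ℕ} (Mh : Fin dh → Matrix (Fin a) (Fin a) (MvPolynomial τ ℝ≥0))
    (Mg : Fin dg → Matrix (Fin b) (Fin b) (MvPolynomial τ ℝ≥0)) :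
    (List.ofFn (Fin.append (fun l => Matrix.fromBlocks (Mh l) 0 0 (1 : Matrix (Fin b) (Fin b) _))
      (fun l => Matrix.fromBlocks (1 : Matrix (Fin a) (Fin a) _) 0 0 (Mg l)))).prod =
      Matrix.fromBlocks (List.ofFn Mh).prod 0 0 (List.ofFn Mg).prod := by
  have hh : List.ofFn (fun l => Matrix.fromBlocks (Mh l) 0 0 (1 : Matrix (Fin b) (Fin b) _)) =
      (List.ofFn Mh).map fun A => Matrix.fromBlocks A 0 0 (1 : Matrix (Fin b) (Fin b) _) := by
    rw [List.map_ofFn]; rfl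
  have hg : List.ofFn (fun l => Matrix.fromBlocks (1 : Matrix (Fin a) (Fin a) _) 0 0 (Mg l)) =
      (List.ofFn Mg).map fun B => Matrix.fromBlocks (1 : Matrix (Fin a) (Fin a) _) 0 0 B := by
    rw [List.map_ofFn]; rfl
  rw [List.ofFn_fin_append, List.prod_append, hh, hg, FormulaToIMM.prod_map_inl,
    FormulaToIMM.prod_map_inr, Matrix.fromBlocks_multiply]
  simp

end SpanOfCertificate

open SpanOfCertificate

/-! ### The stub: a small-degree division certificate is one Kirchhoff quotient -/

/-- **Converse normal form (registered support stub `stub_spanOfCertificate`).**  Over `ℝ≥0`, if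
`f · h = g` with `h ≠ 0`, and `g`, `h` have complexity `≤ 2^E`, total degree `< 2^E` on a variable
type of cardinality `≤ 2^E` (`1 ≤ E`), then `f · A = B` for some `A ≠ 0` and `A, B` positive
projections of `stPoly ℝ≥0 N` with `N ≤ 2^(700 E²)`.  Proof: monotone balancing over the semiring
(`formulaComplexity_le_two_pow`), `stub_formulaToIMM` at `k = ℝ≥0`, one block-diagonal program for
`h` and `g` (`prod_append_blocks`), and the padding lemma `stub_immToSpan` with its COMMON cofactor
`A`: `h A = B₁`, `g A = B₂`, so `f · B₁ = B₂`, `B₁ ≠ 0`. [folklore] -/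
theorem stub_spanOfCertificate :
    ∀ (τ : Type) [Fintype τ] (f g h : MvPolynomial τ NNReal) (E : ℕ), h ≠ 0 → f * h = g → 1 ≤ E →
      g.totalDegree < 2 ^ E → h.totalDegree < 2 ^ E → Fintype.card τ ≤ 2 ^ E →
      Literature.Computability.AlgebraicComplexity.complexity g ≤ 2 ^ E →
      Literature.Computability.AlgebraicComplexity.complexity h ≤ 2 ^ E →
      ∃ N ≤ 2 ^ (700 * E ^ 2), ∃ A B : MvPolynomial τ NNReal,
        Literature.Computability.AlgebraicComplexity.IsProjection A
            (Literature.Barriers.ValiantsHypothesis.stPoly NNReal N) ∧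
        Literature.Computability.AlgebraicComplexity.IsProjection B
            (Literature.Barriers.ValiantsHypothesis.stPoly NNReal N) ∧
        A ≠ 0 ∧ f * A = B := by
  intro τ _ f g h E hh hfg hE hdg hdh hcard hLg hLh
  classical
  -- monotone formulas (balancing over the semiring `ℝ≥0`)
  have hFg : formulaComplexity g ≤ 2 ^ (18 * E ^ 2) := formulaComplexity_le_two_pow le_rfl hdg hcard hLg hE
  have hFh : formulaComplexity h ≤ 2 ^ (18 * E ^ 2) := formulaComplexity_le_two_pow le_rfl hdh hcard hLh hE
  -- labelled programs
  obtain ⟨wg, dg, Mg, sg, tg, hwg, hdg', hlabg, hpg⟩ := stub_formulaToIMM NNReal τ g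
  obtain ⟨wh, dh, Mh, sh, th, hwh, hdh', hlabh, hph⟩ := stub_formulaToIMM NNReal τ h
  -- side by side
  set D : Fin (dh + dg) → Matrix (Fin wh ⊕ Fin wg) (Fin wh ⊕ Fin wg) (MvPolynomial τ ℝ≥0) :=
    Fin.append (fun l => Matrix.fromBlocks (Mh l) 0 0 (1 : Matrix (Fin wg) (Fin wg) _))
      (fun l => Matrix.fromBlocks (1 : Matrix (Fin wh) (Fin wh) _) 0 0 (Mg l)) with hDdef
  have hDlab : ∀ l i j, (∃ x, D l i j = X x) ∨ ∃ c, D l i j = C c := by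
    intro l
    refine Fin.addCases (fun l => ?_) (fun l => ?_) l
    · rw [hDdef, Fin.append_left]; exact isLab_inl (hlabh l)
    · rw [hDdef, Fin.append_right]; exact isLab_inr (hlabg l)
  have hprod : (List.ofFn D).prod = Matrix.fromBlocks (List.ofFn Mh).prod 0 0 (List.ofFn Mg).prod :=
    prod_append_blocks Mh Mg
  obtain ⟨N, hN, A, hA, hA0, hB⟩ := stub_immToSpan τ (Fin wh ⊕ Fin wg) (dh + dg) D hDlab
  obtain ⟨B₁, hB₁, hB₁eq⟩ := hB (Sum.inl sh) (Sum.inl th)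
  obtain ⟨B₂, hB₂, hB₂eq⟩ := hB (Sum.inr sg) (Sum.inr tg)
  rw [hprod, Matrix.fromBlocks_apply₁₁, ← hph] at hB₁eq
  rw [hprod, Matrix.fromBlocks_apply₂₂, ← hpg] at hB₂eq
  refine ⟨N, ?_, B₁, B₂, hB₁, hB₂, ?_, ?_⟩
  · -- size
    have hc : Fintype.card (Fin wh ⊕ Fin wg) = wh + wg := by simp
    rw [hc] at hN
    have h1 : wh + wg + (dh + dg) + 1 ≤ 5 * (4 * (2 ^ (18 * E ^ 2) + 1) ^ 4) + 1 := by
      have hg4 : 4 * (formulaComplexity g + 1) ^ 4 ≤ 4 * (2 ^ (18 * E ^ 2) + 1) ^ 4 :=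
        Nat.mul_le_mul_left 4 (Nat.pow_le_pow_left (Nat.succ_le_succ hFg) 4)
      have hh4 : 4 * (formulaComplexity h + 1) ^ 4 ≤ 4 * (2 ^ (18 * E ^ 2) + 1) ^ 4 :=
        Nat.mul_le_mul_left 4 (Nat.pow_le_pow_left (Nat.succ_le_succ hFh) 4)
      omega
    calc N ≤ 4 * (wh + wg + (dh + dg) + 1) ^ 8 := hN
      _ ≤ 4 * (5 * (4 * (2 ^ (18 * E ^ 2) + 1) ^ 4) + 1) ^ 8 :=
          Nat.mul_le_mul_left 4 (Nat.pow_le_pow_left h1 8)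
      _ ≤ 2 ^ (700 * E ^ 2) := SignedSpan.span_size_le hE le_rfl
  · rw [← hB₁eq]; exact mul_ne_zero hh hA0
  · rw [← hB₁eq, ← hB₂eq, ← hfg]; ring

/-! ### Corollaries: monotone-easy polynomials, and `ZeroOneTransfer` with a degree clause -/

/-- Degrees are invariant under an injective change of scalars. [folklore] -/
theorem SpanOfCertificate.totalDegree_map_of_injective {R S : Type*} [CommSemiring R] [CommSemiring S]
    {τ : Type*} (p : MvPolynomial τ R) {φ : R →+* S} (hφ : Function.Injective φ) :
    (MvPolynomial.map φ p).totalDegree = p.totalDegree := by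
  simp only [totalDegree, support_map_of_injective p hφ]

/-- Quasi-polynomially bounded functions are closed under addition. [folklore] -/
theorem SpanOfCertificate.isQPBounded_add {a b : ℕ → ℕ} (ha : IsQPBounded a) (hb : IsQPBounded b) :
    IsQPBounded (fun n => a n + b n) := by
  obtain ⟨c₁, h₁⟩ := ha
  obtain ⟨c₂, h₂⟩ := hb
  refine ⟨c₁ + c₂ + 2, fun n => ?_⟩
  set ℓ := Nat.log 2 n
  set m := c₁ + c₂ + 2 with hm
  have hx1 : (ℓ + c₁) ^ c₁ ≤ (ℓ + m) ^ (c₁ + c₂ + 1) :=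
    (Nat.pow_le_pow_left (by omega) _).trans (Nat.pow_le_pow_right (by omega) (by omega))
  have hx2 : (ℓ + c₂) ^ c₂ ≤ (ℓ + m) ^ (c₁ + c₂ + 1) :=
    (Nat.pow_le_pow_left (by omega) _).trans (Nat.pow_le_pow_right (by omega) (by omega))
  have hsum : (ℓ + m) ^ (c₁ + c₂ + 1) + 1 ≤ (ℓ + m) ^ m := by
    have h1 : 1 ≤ (ℓ + m) ^ (c₁ + c₂ + 1) := Nat.one_le_pow _ _ (by omega)
    calc (ℓ + m) ^ (c₁ + c₂ + 1) + 1 ≤ 2 * (ℓ + m) ^ (c₁ + c₂ + 1) := by omega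
      _ ≤ (ℓ + m) * (ℓ + m) ^ (c₁ + c₂ + 1) := Nat.mul_le_mul_right _ (by omega)
      _ = (ℓ + m) ^ m := by rw [hm, ← pow_succ']
  calc a n + b n ≤ 2 ^ ((ℓ + c₁) ^ c₁) + 2 ^ ((ℓ + c₂) ^ c₂) := Nat.add_le_add (h₁ n) (h₂ n)
    _ ≤ 2 ^ ((ℓ + m) ^ (c₁ + c₂ + 1)) + 2 ^ ((ℓ + m) ^ (c₁ + c₂ + 1)) :=
        Nat.add_le_add (Nat.pow_le_pow_right two_pos hx1) (Nat.pow_le_pow_right two_pos hx2)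
    _ = 2 ^ ((ℓ + m) ^ (c₁ + c₂ + 1) + 1) := by rw [pow_succ]; ring
    _ ≤ 2 ^ ((ℓ + m) ^ m) := Nat.pow_le_pow_right two_pos hsum

/-- **Monotone-easy polynomials are single Kirchhoff quotients** (the planner's padding corollary:
refutes the panel's cheap falsifiers `IMM_{3,n}`, `e_k` of the span): `complexity f ≤ 2^E`,
`deg f < 2^E`, `#τ ≤ 2^E`, `1 ≤ E` give `f · A = B` over `ST_N`, `A ≠ 0`, `N ≤ 2^(700 E²)`
(`stub_spanOfCertificate` with `h = 1`). [folklore] -/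
theorem span_of_monotone {τ : Type} [Fintype τ] (f : MvPolynomial τ ℝ≥0) {E : ℕ} (hE : 1 ≤ E)
    (hdeg : f.totalDegree < 2 ^ E) (hcard : Fintype.card τ ≤ 2 ^ E) (hL : complexity f ≤ 2 ^ E) :
    ∃ N ≤ 2 ^ (700 * E ^ 2), ∃ A B : MvPolynomial τ ℝ≥0,
      IsProjection A (stPoly ℝ≥0 N) ∧ IsProjection B (stPoly ℝ≥0 N) ∧ A ≠ 0 ∧ f * A = B := by
  have h1 : complexity (1 : MvPolynomial τ ℝ≥0) ≤ 2 ^ E := by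
    rw [← C_1, complexity_C_holds (σ := τ) (1 : ℝ≥0)]; exact Nat.zero_le _
  have hd1 : (1 : MvPolynomial τ ℝ≥0).totalDegree < 2 ^ E := by
    rw [totalDegree_one]; exact Nat.two_pow_pos E
  exact stub_spanOfCertificate τ f f 1 E one_ne_zero (mul_one f) hE hdeg hd1 hcard hL h1

/-- **`ZeroOneTransfer` with a quasi-polynomial bound on the cofactor degree puts every 0/1 `VP_ℂ`
family over `ℝ≥0` into the arborescence span with ONE term on each side** (`f_n · A = B`, `A ≠ 0`,
`A, B ∈ Proj(ST_N)`, `N` quasi-polynomial) — the converse direction of the planner's finding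
"`stub_signElimination` is the crux in Kirchhoff normal form, up to the degree clause".  Proof:
common exponent for `#σ_n` (p-bounded), `deg f_n` (p-bounded, `totalDegree_map_of_injective`) and
`deg f_n + qpB + 1` (qp-bounded, `isQPBounded_add`), then `stub_spanOfCertificate` and
`SignedSpan.sevenHundred_mul_sq_le_pow`. [folklore] -/
theorem span_of_zeroOneTransferDeg
    (H : ∀ (σ : ℕ → Type) [∀ n, Fintype (σ n)] (f : ∀ n, MvPolynomial (σ n) NNReal),
      (∀ n m, MvPolynomial.coeff m (f n) = 0 ∨ MvPolynomial.coeff m (f n) = 1) →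
      Literature.Computability.AlgebraicComplexity.IsVPFamily (k := ℂ)
        (fun n => MvPolynomial.map (Complex.ofRealHom.comp NNReal.toRealHom) (f n)) →
      ∃ c : ℕ, ∀ n, ∃ h : MvPolynomial (σ n) NNReal, h ≠ 0 ∧
        h.totalDegree ≤ 2 ^ ((Nat.log 2 n + c) ^ c) ∧
        Literature.Computability.AlgebraicComplexity.complexity (f n * h) +
          Literature.Computability.AlgebraicComplexity.complexity h ≤ 2 ^ ((Nat.log 2 n + c) ^ c))
    (σ : ℕ → Type) [∀ n, Fintype (σ n)] (f : ∀ n, MvPolynomial (σ n) NNReal)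
    (h01 : ∀ n m, MvPolynomial.coeff m (f n) = 0 ∨ MvPolynomial.coeff m (f n) = 1)
    (hVP : Literature.Computability.AlgebraicComplexity.IsVPFamily (k := ℂ)
      (fun n => MvPolynomial.map (Complex.ofRealHom.comp NNReal.toRealHom) (f n))) :
    ∃ c : ℕ, ∀ n, ∃ N ≤ 2 ^ ((Nat.log 2 n + c) ^ c), ∃ A B : MvPolynomial (σ n) NNReal,
      Literature.Computability.AlgebraicComplexity.IsProjection A
          (Literature.Barriers.ValiantsHypothesis.stPoly NNReal N) ∧
      Literature.Computability.AlgebraicComplexity.IsProjection B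
          (Literature.Barriers.ValiantsHypothesis.stPoly NNReal N) ∧
      A ≠ 0 ∧ f n * A = B := by
  obtain ⟨c, hc⟩ := H σ f h01 hVP
  choose h hne hdegh hcost using hc
  have hinj : Function.Injective (Complex.ofRealHom.comp NNReal.toRealHom) := by
    intro x y hxy
    simpa using hxy
  have hdegP : IsPBounded (fun n => (f n).totalDegree) := by
    obtain ⟨b, hb⟩ := hVP.1.2
    refine ⟨b, fun n => ?_⟩
    have := hb n
    simp only at this
    rwa [SpanOfCertificate.totalDegree_map_of_injective (f n) hinj] at this
  have hone : IsPBounded (fun _ : ℕ => 1) := ⟨1, fun n => by simp⟩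
  have ht : IsQPBounded (fun n => (f n).totalDegree + (2 ^ ((Nat.log 2 n + c) ^ c) + 1)) :=
    SpanOfCertificate.isQPBounded_add hdegP.isQPBounded
      (SpanOfCertificate.isQPBounded_add ⟨c, fun n => le_rfl⟩ hone.isQPBounded)
  obtain ⟨c₀, hc₀⟩ := exists_common_qp_exponent hVP.1.1 hVP.1.1 ht
  refine ⟨2 * c₀ + 10, fun n => ?_⟩
  obtain ⟨hE, -, hcard, htn⟩ := hc₀ n
  have hdfh : (f n * h n).totalDegree < 2 ^ ((Nat.log 2 n + c₀) ^ c₀) :=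
    calc (f n * h n).totalDegree ≤ (f n).totalDegree + (h n).totalDegree := totalDegree_mul _ _
      _ < (f n).totalDegree + (2 ^ ((Nat.log 2 n + c) ^ c) + 1) := by have := hdegh n; omega
      _ ≤ 2 ^ ((Nat.log 2 n + c₀) ^ c₀) := htn
  have hdh : (h n).totalDegree < 2 ^ ((Nat.log 2 n + c₀) ^ c₀) := by have := hdegh n; omega
  have hLg : complexity (f n * h n) ≤ 2 ^ ((Nat.log 2 n + c₀) ^ c₀) := by have := hcost n; omega
  have hLh : complexity (h n) ≤ 2 ^ ((Nat.log 2 n + c₀) ^ c₀) := by have := hcost n; omega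
  obtain ⟨N, hN, A, B, hA, hB, hA0, hfAB⟩ := stub_spanOfCertificate (σ n) (f n) (f n * h n) (h n)
    ((Nat.log 2 n + c₀) ^ c₀) (hne n) rfl hE hdfh hdh hcard hLg hLh
  refine ⟨N, hN.trans ?_, A, B, hA, hB, hA0, hfAB⟩
  exact Nat.pow_le_pow_right two_pos (SignedSpan.sevenHundred_mul_sq_le_pow c₀ (Nat.log 2 n))

end Summit.ValiantsHypothesis.ValiantsHypothesis.Theorems.DivisionGapZeroOneTransfer

end
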